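import Summits.QuantumFields.BalabanUV.Beta.D1BFx.SymMixedJetRecording

/-!
# `BalabanUV.Beta.D1BFx.SymMixedTableMass` — road «BF-x» for binder row D1, junction (J1), the (rest) row's table letter «SYMMIX-MASS» FILE 5 of 5:
# **THE n-LAW OF an1's MIXED-TABLE MASS — `symMixAbs (toSite r) L ≤ 75000 · d · (ell d L)³` FOR EVERY ROOT OFFSET IN THE BOX AND `1 ≤ L`; AT THE CENTRED ROOT
# `symMixAbs (ctr d n) n ≤ 75000 · d · ((2d+2)·n)³` (`≍ n³`; at the road's `d = 4`: `≤ 3·10⁸·n³`)**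

HONEST DEPENDENCY (cell records, verbatim): «continuum YM on T⁴ ⇐ BetaPertH ∧ nine spine estimates (0/9 proved); BetaPertH ⇐ (D1) ∧ (D4) ∧
CAP+tail; G-an2-4 gates asym, D1 and NE2/3/4.»  HONEST FRAMING (cell contract, verbatim): «discharging `BetaPertH` makes Bałaban's UV stability
UNCONDITIONAL — a real constructive-QFT result; it is NOT the continuum limit and NOT the Clay problem.»  THIS MODULE DISCHARGES NOTHING of the
wall: [folklore] bookkeeping BY NAME over an1's `symMixAbs ∕ tripleAbs ∕ symTTab ∕ symATab ∕ symApTab ∕ symMjetAt ∕ symPhiMAt ∕ symPhiGAt` and S2a's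
`loopPAt_length_le_ell ∕ lettersIn_loopPAt_top`, lit node 12 ∕ 12b (`expT ∕ logT ∕ invT ∕ holG ∕ Gm ∕ Gmb ∕ Zf ∕ Zb ∕ ι ∕ segUp_length ∕ lettersIn_segUp_top ∕ bondSet ∕
ell ∕ ctrOff_mem_box`) and FILES 1–4; kernel lane: 0 def, 0 cite, 0 `def … : Prop`, 0 sorry, NO hypothesis displayed.  A TABLE-MASS LETTER for the (rest) row's
supplier (gan24-leaf-05's `StraightPinRestRowMass`: NET `n⁻¹¹·S₀·CΦ·symMixAbs (ctr 4 n) n`): it prices NO word by itself and proves NO (1.22) row; nothing of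
Bałaban's asserted or valued; no value of any table asserted; `S₀`'s `CΓ` untouched; 0 root-level binders of row D1 discharged (hW ∕ hR-sockets ∕ hSX-socket ∕ D1Tel ∕
D1Rep = 0); (J3) DISPLAYED; (J1) ONE OPEN ROW; (K) NOT closed; NOT D1, NEVER «G-an2-4 closed», NOT `BetaPertH`, NOT continuum, NOT Clay.

ABSOLUTE RULE (cell charter, verbatim): «No internally-minted statement may enter as a cited fact. Every hypothesis is either kernel-proved in
this package or a verbatim quotation of a PUBLISHED theorem with page reference. The manuscript(s) under audit are NOT citable for their own
disputed steps — they are the thing under adjudication; programme-internal (2001/route/tribunal) claims are never citable.»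

WHY ∕ HOW.  `symMixAbs ρ L = Σ_μ Σ_{(f,f′,g) ∈ bondSet³} |a_sym(f,g,f′) + a′_sym(f,g,f′) − a_sym(f′,g,f)|`.  By FILE 4 each of the three words is the top row of ONE
element `X = symMjetAt ℚ ρ W♭ V♭ B♭ L μ 0` (resp. `X′`) of the recording algebra, so `Σ |·| ≤ 2·mass₃ X + mass₃ X′` (two re-indexings of the alphabet cube).  With
FILE 2's norm at the level weights `t^{lv}` — submultiplicative, `‖1‖ ≤ 1` — lifted through `Rho` (FILE 1), the chart letters obey `ν₃(U_f − 1) ≤ (1+t)³ − 1`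
(§1), every pair loop of the (0.4) family has `≤ ell d L` letters (S2a) and the coarse bond `L`, so `ν₃(hol − 1) ≤ m^{ell} − 1 =: β` (`m = (1+t)³`); `logT`,
the (0.4) mean (exact `((d!)²L^d)⁻¹ × #` cancellation), `expT`, the product with `hol(c)`, `invT`, the product and the final `logT` are FILE 1's polynomial
letters, ending in `ν(X) ≤ Kmix β` (§2).  At `t := 1∕(25·ell)`: `β ≤ 25∕22 − 1 = 3∕22` (`(1+t)^n ≤ 1∕(1 − n t)`), `Kmix (3∕22) ≤ 8∕5`, and the extraction
`Σ_w |X_{•,(w)}| ≤ t⁻³·(8∕5) = 25000·ell³` (§3); summing the three words and the `d` directions gives `75000·d·ell³` (§4).  The numeral is honest and crude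
(no cancellation inside `logT ∕ expT` is used); only the LAW `≍ ell³ ≍ n³` is the point — eight powers inside the (rest) row's room `n¹¹`.

CONTENT ([folklore] throughout).  §1 **`rhoRS_Gm_sub_one_le ∕ rhoRS_Gmb_sub_one_le`** (`≤ (1+t)³ − 1` from `ν W, ν V, ν B ≤ t`); §2
`logT_loop_le ∕ mean_le ∕ seg_sub_one_le`, **`symPhiGAt_sub_one_le`** (`ν(Φ^{ρ,sym}_b − 1) ≤ phiC β`, ANY `ℚ`-algebra with a ring seminorm — instances shared with an1's definitions), **`norm_symMjetAt_le`** (`ν(M^{ρ,sym}_b) ≤ Kmix β`) — generic normed `ℚ`-algebra, both charts;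
§3 **`sum_abs_entry_le`** (recording algebra at `t = 1∕(25 ell)`: top-row mass `≤ 25000·ell³` for any assignment of the three recording forms); §4
`sum_bondSet_cube_eq`, **`symMixAbs_le`**, **`symMixAbs_ctr_le`**.
NOT HERE (honest): the (rest) row itself and its `S₀·CΦ`; the first-order ∕ border tables (gan24-leaf-05's `SymHessTablePairMass` route); any sharper numeral
(a level-by-level profile would give `≍ #letters³`); all-`μ` or per-`μ` variants (on ask).
Unit `b2b-balaban-beta-d1-formalise-leaf-04` (gen 29), D1 formalisation swarm LEAF PROVER 04, road «BF-x» supplier; INTENT I-leaf04-g29-1 «SYMMIX-MASS»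
(journal), taking the OWNER d1-p2 g25's located WANTED «the n-law of `symMixAbs`» (W-g25-9 (a)).  Not in print; our bookkeeping.  No existing file touched.
-/

noncomputable section

open Finset
open scoped BigOperators Nat
open Literature.MathematicalPhysics.QuantumFieldTheory.Balaban1983to89.Beta
open Literature.MathematicalPhysics.QuantumFieldTheory.Balaban1983to89.Beta.AffineAveraging
open Literature.MathematicalPhysics.QuantumFieldTheory.Balaban1983to89.Beta.AveragingContours
open Literature.MathematicalPhysics.QuantumFieldTheory.Balaban1983to89.Beta.AveragingContoursRooted
open Literature.MathematicalPhysics.QuantumFieldTheory.Balaban1983to89.Beta.AveragingHessianKernels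
open Literature.MathematicalPhysics.QuantumFieldTheory.Balaban1983to89.Beta.AveragingThirdJet
open Literature.MathematicalPhysics.QuantumFieldTheory.Balaban1983to89.Beta.AveragingThirdJet.Tau
open Literature.MathematicalPhysics.QuantumFieldTheory.Balaban1983to89.Beta.AveragingMixedJetTables
open Summit.QuantumFields.BalabanUV.Beta.SymAveragingHessianCounts (loopPAt loopPAt_length_le_ell)
open Summit.QuantumFields.BalabanUV.Beta.SymAveragingMixedJetTables
open Summit.QuantumFields.BalabanUV.Beta.D1BFx.TruncatedAlgebraNorms
open Summit.QuantumFields.BalabanUV.Beta.D1BFx.WeightedRowSumNorm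
open Summit.QuantumFields.BalabanUV.Beta.D1BFx.WordRecordingAlgebra
open Summit.QuantumFields.BalabanUV.Beta.D1BFx.SymMixedJetRecording

namespace Summit.QuantumFields.BalabanUV.Beta.D1BFx.SymMixedTableMass

/-! ## §1 The chart letters of the mixed chart in the `Rho` lift of a ring seminorm -/

section Chain

variable {d : ℕ} {𝔸 : Type*} [Ring 𝔸] [Algebra ℚ 𝔸] (ν : RingSeminorm 𝔸)

/-- [folklore] **THE CHART LETTERS**: with `ν W_f, ν V_f, ν B_f ≤ t` one has `ν₃ (U_f − 1) ≤ (1+t)³ − 1` for the forward transporter of the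
mixed chart. -/
theorem rhoRS_Gm_sub_one_le (h1 : ν 1 ≤ 1) (hs : ∀ (c : ℚ) (y : 𝔸), ν (algebraMap ℚ 𝔸 c * y) ≤ |(c : ℝ)| * ν y) {t : ℝ} (ht : 0 ≤ t) {W V B : Form1 d 𝔸} (hW : ∀ κ x, ν (W κ x) ≤ t)
    (hV : ∀ κ x, ν (V κ x) ≤ t) (hB : ∀ κ x, ν (B κ x) ≤ t) (κ : Fin d) (x : Fin d → ℤ) :
    rhoRS ν (Gm ℚ W V B κ x - 1) ≤ (1 + t) ^ 3 - 1 := by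
  have h21 : tauRS ν 1 ≤ 1 := tauRS_one_le ν h1
  have hsym : ν ((2 : ℚ)⁻¹ • (W κ x * V κ x + V κ x * W κ x)) ≤ t ^ 2 := by
    rw [Algebra.smul_def]
    refine (hs _ _).trans ?_
    rw [show |((2⁻¹ : ℚ) : ℝ)| = 1 / 2 by norm_num]
    have h0 := (map_add_le_add ν _ _).trans (add_le_add ((map_mul_le_mul ν _ _).trans (mul_le_mul (hW κ x) (hV κ x) (apply_nonneg ν _) ht))
      ((map_mul_le_mul ν _ _).trans (mul_le_mul (hV κ x) (hW κ x) (apply_nonneg ν _) ht)))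
    nlinarith
  have hZ1 : tauRS ν (Zf ℚ W V κ x - 1) ≤ 2 * t + t ^ 2 := by
    rw [tauRS_apply]
    simp only [Zf, c00_sub, c10_sub, c01_sub, c11_sub, c00_mk, c10_mk, c01_mk, c11_mk, c00_one, c10_one, c01_one, c11_one,
      sub_self, sub_zero, map_zero]
    linarith [hW κ x, hV κ x]
  have hZ : tauRS ν (Zf ℚ W V κ x) ≤ 1 + 2 * t + t ^ 2 := by linarith [le_of_sub_one_le (tauRS ν) h21 hZ1]
  have hι : tauRS ν (ι (B κ x)) ≤ t := by
    rw [tauRS_apply]; simp only [c00_ι, c10_ι, c01_ι, c11_ι, map_zero]; linarith [hB κ x]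
  have hprod : tauRS ν (Zf ℚ W V κ x * ι (B κ x)) ≤ (1 + 2 * t + t ^ 2) * t :=
    (map_mul_le_mul (tauRS ν) _ _).trans (mul_le_mul hZ hι (apply_nonneg (tauRS ν) _) (by positivity))
  rw [rhoRS_apply]
  simp only [Gm, TrivSqZeroExt.fst_sub, TrivSqZeroExt.snd_sub, fst_dmk, snd_dmk, TrivSqZeroExt.fst_one, TrivSqZeroExt.snd_one,
    sub_zero]
  nlinarith

/-- [folklore] … and `ν₃ (U_f⁻¹ − 1) ≤ (1+t)³ − 1` for the backward transporter. -/
theorem rhoRS_Gmb_sub_one_le (h1 : ν 1 ≤ 1) (hs : ∀ (c : ℚ) (y : 𝔸), ν (algebraMap ℚ 𝔸 c * y) ≤ |(c : ℝ)| * ν y) {t : ℝ} (ht : 0 ≤ t) {W V B : Form1 d 𝔸} (hW : ∀ κ x, ν (W κ x) ≤ t)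
    (hV : ∀ κ x, ν (V κ x) ≤ t) (hB : ∀ κ x, ν (B κ x) ≤ t) (κ : Fin d) (x : Fin d → ℤ) :
    rhoRS ν (Gmb ℚ W V B κ x - 1) ≤ (1 + t) ^ 3 - 1 := by
  have h21 : tauRS ν 1 ≤ 1 := tauRS_one_le ν h1
  have hsym : ν ((2 : ℚ)⁻¹ • (W κ x * V κ x + V κ x * W κ x)) ≤ t ^ 2 := by
    rw [Algebra.smul_def]
    refine (hs _ _).trans ?_
    rw [show |((2⁻¹ : ℚ) : ℝ)| = 1 / 2 by norm_num]
    have h0 := (map_add_le_add ν _ _).trans (add_le_add ((map_mul_le_mul ν _ _).trans (mul_le_mul (hW κ x) (hV κ x) (apply_nonneg ν _) ht))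
      ((map_mul_le_mul ν _ _).trans (mul_le_mul (hV κ x) (hW κ x) (apply_nonneg ν _) ht)))
    nlinarith
  have hZ1 : tauRS ν (Zb ℚ W V κ x - 1) ≤ 2 * t + t ^ 2 := by
    rw [tauRS_apply]
    simp only [Zb, c00_sub, c10_sub, c01_sub, c11_sub, c00_mk, c10_mk, c01_mk, c11_mk, c00_one, c10_one, c01_one, c11_one,
      sub_self, sub_zero, map_zero, map_neg_eq_map]
    linarith [hW κ x, hV κ x]
  have hZ : tauRS ν (Zb ℚ W V κ x) ≤ 1 + 2 * t + t ^ 2 := by linarith [le_of_sub_one_le (tauRS ν) h21 hZ1]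
  have hι : tauRS ν (ι (B κ x)) ≤ t := by
    rw [tauRS_apply]; simp only [c00_ι, c10_ι, c01_ι, c11_ι, map_zero]; linarith [hB κ x]
  have hprod : tauRS ν (-(ι (B κ x) * Zb ℚ W V κ x)) ≤ t * (1 + 2 * t + t ^ 2) := by
    rw [map_neg_eq_map]
    exact (map_mul_le_mul (tauRS ν) _ _).trans (mul_le_mul hι hZ (apply_nonneg (tauRS ν) _) ht)
  rw [rhoRS_apply]
  simp only [Gmb, TrivSqZeroExt.fst_sub, TrivSqZeroExt.snd_sub, fst_dmk, snd_dmk, TrivSqZeroExt.fst_one, TrivSqZeroExt.snd_one,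
    sub_zero]
  nlinarith

end Chain

/-! ## §2 The (0.4)-averaging step in a generic normed `ℚ`-algebra (instances shared with an1's definitions verbatim) -/

section Averaging

variable {d : ℕ} {R : Type*} [Ring R] [Algebra ℚ R] (νR : RingSeminorm R)

/-- [folklore] (0.4)-averaging, step 1: every pair loop's `logT hol` has `ν ≤ plog β` when `ν (U − 1) ≤ m − 1` and `m^ell − 1 ≤ β`. -/
theorem logT_loop_le (h1 : νR 1 ≤ 1) (hs : ∀ (c : ℚ) (y : R), νR (algebraMap ℚ R c * y) ≤ |(c : ℝ)| * νR y) {m β : ℝ} (hm : 1 ≤ m)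
    {G Gb : Form1 d R} (hG : ∀ κ x, νR (G κ x - 1) ≤ m - 1) (hGb : ∀ κ x, νR (Gb κ x - 1) ≤ m - 1)
    {L : ℕ} (hL : 1 ≤ L) {r : Fin d → ℕ} (hr : r ∈ box d L) (hβ : m ^ ell d L - 1 ≤ β) (μ : Fin d) (y : Fin d → ℤ)
    {b : Fin d → ℕ} (hb : b ∈ box d L) (σ σ' : Equiv.Perm (Fin d)) :
    νR (logT ℚ (holG G Gb (loopPAt σ σ' (toSite r) δ L μ y b))) ≤ plog β := by
  have h1' := holG_sub_one_le νR h1 hm (P := fun _ => True) (fun κ x _ => hG κ x) (fun κ x _ => hGb κ x)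
    (lettersIn_loopPAt_top σ σ' (toSite r) δ L μ y b)
  have hlen := loopPAt_length_le_ell σ σ' (δ : Form1 d (LetterGrp d)) hL μ y hr hb
  exact logT_le νR hs (h1'.trans ((sub_le_sub_right (pow_le_pow_right₀ hm hlen) 1).trans hβ))

/-- [folklore] (0.4)-averaging, step 2: the MEAN of the loop logarithms has `ν ≤ plog β` (exact `((d!)²L^d)⁻¹ × #` cancellation). -/
theorem mean_le (h1 : νR 1 ≤ 1) (hs : ∀ (c : ℚ) (y : R), νR (algebraMap ℚ R c * y) ≤ |(c : ℝ)| * νR y) {m β : ℝ} (hm : 1 ≤ m)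
    {G Gb : Form1 d R} (hG : ∀ κ x, νR (G κ x - 1) ≤ m - 1) (hGb : ∀ κ x, νR (Gb κ x - 1) ≤ m - 1)
    {L : ℕ} (hL : 1 ≤ L) {r : Fin d → ℕ} (hr : r ∈ box d L) (hβ : m ^ ell d L - 1 ≤ β) (μ : Fin d) (y : Fin d → ℤ) :
    νR (algebraMap ℚ R (((d ! : ℚ) ^ 2 * (L : ℚ) ^ d))⁻¹ * ∑ b ∈ box d L, ∑ σ : Equiv.Perm (Fin d),
      ∑ σ' : Equiv.Perm (Fin d), logT ℚ (holG G Gb (loopPAt σ σ' (toSite r) δ L μ y b))) ≤ plog β := by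
  have hbox : (box d L).card = L ^ d := by
    simp only [AffineAveraging.box, Fintype.card_piFinset, Finset.card_range, Finset.prod_const, Finset.card_univ, Fintype.card_fin]
  have hperm : (Finset.univ : Finset (Equiv.Perm (Fin d))).card = d ! := by
    rw [Finset.card_univ, Fintype.card_perm, Fintype.card_fin]
  have hsum : νR (∑ b ∈ box d L, ∑ σ : Equiv.Perm (Fin d), ∑ σ' : Equiv.Perm (Fin d),
      logT ℚ (holG G Gb (loopPAt σ σ' (toSite r) δ L μ y b))) ≤ (L ^ d : ℕ) * ((d ! : ℕ) * ((d ! : ℕ) * plog β)) := by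
    rw [← hbox, ← hperm]
    refine sum_le_card_mul νR _ _ fun b hb => sum_le_card_mul νR _ _ fun σ _ =>
      sum_le_card_mul νR _ _ fun σ' _ => logT_loop_le νR h1 hs hm hG hGb hL hr hβ μ y hb σ σ'
  have hL0 : (L : ℝ) ≠ 0 := by exact_mod_cast (show L ≠ 0 by omega)
  have hd0 : ((d ! : ℕ) : ℝ) ≠ 0 := by exact_mod_cast (Nat.factorial_pos d).ne'
  refine (hs _ _).trans ?_
  have habs : |(((((d ! : ℚ) ^ 2 * (L : ℚ) ^ d))⁻¹ : ℚ) : ℝ)| = (((d ! : ℕ) : ℝ) ^ 2 * (L : ℝ) ^ d)⁻¹ := by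
    push_cast
    rw [abs_inv, abs_of_nonneg (by positivity)]
  rw [habs]
  calc (((d ! : ℕ) : ℝ) ^ 2 * (L : ℝ) ^ d)⁻¹ * νR (∑ b ∈ box d L, ∑ σ : Equiv.Perm (Fin d), ∑ σ' : Equiv.Perm (Fin d),
        logT ℚ (holG G Gb (loopPAt σ σ' (toSite r) δ L μ y b)))
      ≤ (((d ! : ℕ) : ℝ) ^ 2 * (L : ℝ) ^ d)⁻¹ * ((L ^ d : ℕ) * ((d ! : ℕ) * ((d ! : ℕ) * plog β))) :=
        mul_le_mul_of_nonneg_left hsum (by positivity)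
    _ = plog β := by push_cast; field_simp

omit [Algebra ℚ R] in
/-- [folklore] (0.4)-averaging, step 3: the coarse bond's holonomy has `ν (hol(c) − 1) ≤ β`. -/
theorem seg_sub_one_le (h1 : νR 1 ≤ 1) {m β : ℝ} (hm : 1 ≤ m) {G Gb : Form1 d R}
    (hG : ∀ κ x, νR (G κ x - 1) ≤ m - 1) (hGb : ∀ κ x, νR (Gb κ x - 1) ≤ m - 1)
    {L : ℕ} (hβ : m ^ ell d L - 1 ≤ β) (ρ : Fin d → ℤ) (μ : Fin d) (y : Fin d → ℤ) :
    νR (holG G Gb (segUp δ ((L : ℤ) • y + ρ) μ L) - 1) ≤ β := by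
  have h1' := holG_sub_one_le νR h1 hm (P := fun _ => True) (fun κ x _ => hG κ x) (fun κ x _ => hGb κ x)
    (lettersIn_segUp_top δ ((L : ℤ) • y + ρ) μ L)
  rw [segUp_length] at h1'
  have hlen : L ≤ ell d L := by unfold ell; nlinarith
  exact h1'.trans ((sub_le_sub_right (pow_le_pow_right₀ hm hlen) 1).trans hβ)

/-- [folklore] **THE (0.4)-AVERAGING STEP**: if both transporter families have `ν (U − 1) ≤ m − 1` (`1 ≤ m`) and `m^ell − 1 ≤ β`, then
`ν (Φ^{ρ,sym}_b − 1) ≤ φ(β)` for every root offset in the box (`1 ≤ L`) — any `ℚ`-algebra with a ring seminorm, `ν 1 ≤ 1`, `ν(c·x) ≤ |c|·ν x`. -/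
theorem symPhiGAt_sub_one_le (h1 : νR 1 ≤ 1) (hs : ∀ (c : ℚ) (y : R), νR (algebraMap ℚ R c * y) ≤ |(c : ℝ)| * νR y) {m β : ℝ}
    (hm : 1 ≤ m) {G Gb : Form1 d R} (hG : ∀ κ x, νR (G κ x - 1) ≤ m - 1) (hGb : ∀ κ x, νR (Gb κ x - 1) ≤ m - 1)
    {L : ℕ} (hL : 1 ≤ L) {r : Fin d → ℕ} (hr : r ∈ box d L) (hβ : m ^ ell d L - 1 ≤ β) (μ : Fin d) (y : Fin d → ℤ) :
    νR (symPhiGAt ℚ (toSite r) G Gb L μ y - 1) ≤ phiC β := by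
  have hexp := expT_sub_one_le νR hs (mean_le νR h1 hs hm hG hGb hL hr hβ μ y)
  have hseg := seg_sub_one_le νR h1 hm hG hGb hβ (toSite r) μ y
  rw [symPhiGAt, Algebra.smul_def]
  refine (mul_sub_one_le νR hexp hseg).trans (le_of_eq ?_)
  unfold phiC pexp; ring

end Averaging

section Jet

variable {d : ℕ} {𝔸 : Type*} [Ring 𝔸] [Algebra ℚ 𝔸] (ν : RingSeminorm 𝔸)

/-- [folklore] **THE MIXED JET IN NORM**: `ν (M^{ρ,sym}_b(W,V;B)) ≤ K(β)` under the chart-letter bounds (both charts) and `m^ell − 1 ≤ β`. -/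
theorem norm_symMjetAt_le (h1 : ν 1 ≤ 1) (hs : ∀ (c : ℚ) (y : 𝔸), ν (algebraMap ℚ 𝔸 c * y) ≤ |(c : ℝ)| * ν y) {m β : ℝ} (hm : 1 ≤ m) {W V B : Form1 d 𝔸}
    (hU : ∀ κ x, rhoRS ν (Gm ℚ W V B κ x - 1) ≤ m - 1) (hUb : ∀ κ x, rhoRS ν (Gmb ℚ W V B κ x - 1) ≤ m - 1)
    (hE : ∀ κ x, rhoRS ν (Gm ℚ 0 0 B κ x - 1) ≤ m - 1) (hEb : ∀ κ x, rhoRS ν (Gmb ℚ 0 0 B κ x - 1) ≤ m - 1)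
    {L : ℕ} (hL : 1 ≤ L) {r : Fin d → ℕ} (hr : r ∈ box d L) (hβ : m ^ ell d L - 1 ≤ β) (μ : Fin d) (y : Fin d → ℤ) :
    ν (symMjetAt ℚ (toSite r) W V B L μ y) ≤ Kmix β := by
  have hΦU : rhoRS ν (symPhiMAt ℚ (toSite r) W V B L μ y - 1) ≤ phiC β :=
    symPhiGAt_sub_one_le (rhoRS ν) (rhoRS_one_le ν h1) (rhoRS_smul_le ν hs) hm hU hUb hL hr hβ μ y
  have hΦE : rhoRS ν (symPhiMAt ℚ (toSite r) 0 0 B L μ y - 1) ≤ phiC β :=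
    symPhiGAt_sub_one_le (rhoRS ν) (rhoRS_one_le ν h1) (rhoRS_smul_le ν hs) hm hE hEb hL hr hβ μ y
  have hinv : rhoRS ν (invT (symPhiMAt ℚ (toSite r) 0 0 B L μ y) - 1) ≤ psiC β := invT_sub_one_le (rhoRS ν) hΦE
  have hprod := mul_sub_one_le (rhoRS ν) hΦU hinv
  have hlog := logT_le (rhoRS ν) (rhoRS_smul_le ν hs) hprod
  rw [symMjetAt]
  exact (c11_snd_le_rhoRS ν _).trans hlog

end Jet

/-! ## §3 The recording algebra at `t = 1∕(25·ell)`: the top-row masses of `X` and `X′` are `≤ 25000·ell³` -/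

section Mass

variable {d L : ℕ}

/-- [folklore] **TOP-ROW MASS of a recording-algebra mixed jet**: for any choice of the three recording forms as `(W, V, B)` with norms `≤ t`,
`Σ_{w ∈ S³} |X_{•,(w)}| ≤ 25000·ell³`. -/
theorem sum_abs_entry_le (hL : 1 ≤ L) {r : Fin d → ℕ} (hr : r ∈ box d L) (μ : Fin d) {W V B : Form1 d (recAlg (SB d L))}
    (hW : ∀ {t : ℝ}, 0 < t → ∀ κ x, mnorm (lvW t) (W κ x : Matrix (Idx (SB d L)) (Idx (SB d L)) ℚ) ≤ t)
    (hV : ∀ {t : ℝ}, 0 < t → ∀ κ x, mnorm (lvW t) (V κ x : Matrix (Idx (SB d L)) (Idx (SB d L)) ℚ) ≤ t)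
    (hB : ∀ {t : ℝ}, 0 < t → ∀ κ x, mnorm (lvW t) (B κ x : Matrix (Idx (SB d L)) (Idx (SB d L)) ℚ) ≤ t) :
    ∑ w : SB d L × SB d L × SB d L,
        |(((symMjetAt ℚ (toSite r) W V B L μ 0 : recAlg (SB d L)) : Matrix (Idx (SB d L)) (Idx (SB d L)) ℚ)
          Idx.nil (Idx.three w.1 w.2.1 w.2.2) : ℝ)| ≤ 25000 * (ell d L : ℝ) ^ 3 := by
  have hell : (1 : ℝ) ≤ ell d L := by unfold ell; exact_mod_cast (show 1 ≤ (2 * d + 2) * L by nlinarith)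
  obtain ⟨t, ht_def⟩ : ∃ t : ℝ, t = 1 / (25 * ell d L) := ⟨_, rfl⟩
  have ht : 0 < t := by rw [ht_def]; positivity
  obtain ⟨ν, hν_def⟩ : ∃ ν : RingSeminorm (recAlg (SB d L)), ν = restrictRS (mnormRS (lvW_pos ht)) (recAlg (SB d L)) := ⟨_, rfl⟩
  have hν : ∀ x : recAlg (SB d L), ν x = mnorm (lvW t) (x : Matrix (Idx (SB d L)) (Idx (SB d L)) ℚ) := fun x => by
    rw [hν_def, restrictRS_apply, mnormRS_apply]
  have h1 : ν 1 ≤ 1 := by rw [hν, OneMemClass.coe_one]; exact mnorm_one_le (lvW_pos ht)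
  have hs : ∀ (c : ℚ) (y : recAlg (SB d L)), ν (algebraMap ℚ (recAlg (SB d L)) c * y) ≤ |(c : ℝ)| * ν y := fun c y => by
    rw [hν, hν, MulMemClass.coe_mul, Subalgebra.coe_algebraMap]; exact mnorm_smul_le (lvW_pos ht) c _
  have hWν : ∀ κ x, ν (W κ x) ≤ t := fun κ x => by rw [hν]; exact hW ht κ x
  have hVν : ∀ κ x, ν (V κ x) ≤ t := fun κ x => by rw [hν]; exact hV ht κ x
  have hBν : ∀ κ x, ν (B κ x) ≤ t := fun κ x => by rw [hν]; exact hB ht κ x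
  have h0 : ∀ κ x, ν ((0 : Form1 d (recAlg (SB d L))) κ x) ≤ t := fun κ x => by
    rw [Pi.zero_apply, Pi.zero_apply, map_zero]; exact ht.le
  have hm : (1 : ℝ) ≤ (1 + t) ^ 3 := one_le_pow₀ (by linarith)
  have hU := rhoRS_Gm_sub_one_le ν h1 hs ht.le hWν hVν hBν
  have hUb := rhoRS_Gmb_sub_one_le ν h1 hs ht.le hWν hVν hBν
  have hE := rhoRS_Gm_sub_one_le ν h1 hs ht.le h0 h0 hBν
  have hEb := rhoRS_Gmb_sub_one_le ν h1 hs ht.le h0 h0 hBν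
  -- m^ell − 1 ≤ 3/22 at t = 1/(25 ell)
  have hβ : ((1 + t) ^ 3) ^ ell d L - 1 ≤ 3 / 22 := by
    have h1 : ((1 + t) ^ 3) ^ ell d L = (1 + t) ^ (3 * ell d L) := by rw [pow_mul]
    have h2 : ((3 * ell d L : ℕ) : ℝ) * t = 3 / 25 := by rw [ht_def]; push_cast; field_simp
    have h3 := one_add_pow_le ht.le (n := 3 * ell d L) (by rw [h2]; norm_num)
    rw [h2] at h3
    rw [h1]; linarith [show (1 : ℝ) / (1 - 3 / 25) = 25 / 22 by norm_num]
  have hX : ν (symMjetAt ℚ (toSite r) W V B L μ 0) ≤ 8 / 5 :=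
    (norm_symMjetAt_le ν h1 hs hm hU hUb hE hEb hL hr hβ μ 0).trans Kmix_num
  rw [hν] at hX
  have hrow := sum_three_le ht ((symMjetAt ℚ (toSite r) W V B L μ 0 : recAlg (SB d L)) : Matrix (Idx (SB d L)) (Idx (SB d L)) ℚ)
  have key := hrow.trans hX
  have ht3 : t ^ 3 * (15625 * (ell d L : ℝ) ^ 3) = 1 := by rw [ht_def]; field_simp; norm_num
  have hpos : 0 < 15625 * (ell d L : ℝ) ^ 3 := by positivity
  have hS : 0 ≤ ∑ w : SB d L × SB d L × SB d L,
      |(((symMjetAt ℚ (toSite r) W V B L μ 0 : recAlg (SB d L)) : Matrix (Idx (SB d L)) (Idx (SB d L)) ℚ)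
        Idx.nil (Idx.three w.1 w.2.1 w.2.2) : ℝ)| := Finset.sum_nonneg fun _ _ => abs_nonneg _
  nlinarith

end Mass

/-! ## §4 THE LETTER: `symMixAbs (toSite r) L ≤ 75000 · d · ell³` -/

section Main

variable {d L : ℕ}

/-- [folklore] The reference-block triple sum as a sum over the alphabet cube. -/
theorem sum_bondSet_cube_eq (F : Bond d → Bond d → Bond d → ℝ) :
    ∑ p ∈ (bondSet d L ×ˢ bondSet d L) ×ˢ bondSet d L, F p.1.1 p.1.2 p.2
      = ∑ w : SB d L × SB d L × SB d L, F (w.1 : Bond d) (w.2.1 : Bond d) (w.2.2 : Bond d) := by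
  rw [Finset.sum_product, Finset.sum_product, ← Finset.sum_coe_sort (bondSet d L), Fintype.sum_prod_type]
  refine Finset.sum_congr rfl fun a _ => ?_
  rw [← Finset.sum_coe_sort (bondSet d L), Fintype.sum_prod_type]
  refine Finset.sum_congr rfl fun b _ => ?_
  rw [← Finset.sum_coe_sort (bondSet d L)]

/-- [folklore] **THE n-LAW OF an1's `symMixAbs` (the reference-block `ℓ¹` mass of the symmetrised mixed table `t_sym`)**: for every root offset
in the box and `1 ≤ L`, `symMixAbs (toSite r) L ≤ 75000 · d · (ell d L)³` (`ell d L = (2d+2)·L`). No hypothesis on any table; no value asserted. -/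
theorem symMixAbs_le (hL : 1 ≤ L) {r : Fin d → ℕ} (hr : r ∈ box d L) :
    symMixAbs (toSite r) L ≤ 75000 * d * (ell d L : ℝ) ^ 3 := by
  have hA : ∀ μ : Fin d, ∑ w : SB d L × SB d L × SB d L,
      |(((symMjetAt ℚ (toSite r) (recW d L) (rec12 d L) (rec23 d L) L μ 0 : recAlg (SB d L)) :
        Matrix (Idx (SB d L)) (Idx (SB d L)) ℚ) Idx.nil (Idx.three w.1 w.2.1 w.2.2) : ℝ)| ≤ 25000 * (ell d L : ℝ) ^ 3 :=
    fun μ => sum_abs_entry_le hL hr μ (fun ht => mnorm_recW_le ht) (fun ht => mnorm_rec12_le ht) (fun ht => mnorm_rec23_le ht)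
  have hA' : ∀ μ : Fin d, ∑ w : SB d L × SB d L × SB d L,
      |(((symMjetAt ℚ (toSite r) (recW d L) (rec23 d L) (rec12 d L) L μ 0 : recAlg (SB d L)) :
        Matrix (Idx (SB d L)) (Idx (SB d L)) ℚ) Idx.nil (Idx.three w.1 w.2.1 w.2.2) : ℝ)| ≤ 25000 * (ell d L : ℝ) ^ 3 :=
    fun μ => sum_abs_entry_le hL hr μ (fun ht => mnorm_recW_le ht) (fun ht => mnorm_rec23_le ht) (fun ht => mnorm_rec12_le ht)
  -- the permutations of the alphabet cube used to re-index the second and third words of `t_sym`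
  let e₁ : SB d L × SB d L × SB d L ≃ SB d L × SB d L × SB d L :=
    { toFun := fun w => (w.1, w.2.2, w.2.1), invFun := fun w => (w.1, w.2.2, w.2.1), left_inv := fun _ => rfl, right_inv := fun _ => rfl }
  let e₂ : SB d L × SB d L × SB d L ≃ SB d L × SB d L × SB d L :=
    { toFun := fun w => (w.2.1, w.1, w.2.2), invFun := fun w => (w.2.1, w.1, w.2.2), left_inv := fun _ => rfl, right_inv := fun _ => rfl }
  have hμ : ∀ μ : Fin d, ∑ p ∈ (bondSet d L ×ˢ bondSet d L) ×ˢ bondSet d L,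
      |(symTTab (toSite r) L μ 0 p.1.1 p.1.2 p.2 : ℝ)| ≤ 75000 * (ell d L : ℝ) ^ 3 := by
    intro μ
    rw [sum_bondSet_cube_eq (fun f f' g => |(symTTab (toSite r) L μ 0 f f' g : ℝ)|)]
    set X := ((symMjetAt ℚ (toSite r) (recW d L) (rec12 d L) (rec23 d L) L μ 0 : recAlg (SB d L)) :
        Matrix (Idx (SB d L)) (Idx (SB d L)) ℚ) with hX
    set X' := ((symMjetAt ℚ (toSite r) (recW d L) (rec23 d L) (rec12 d L) L μ 0 : recAlg (SB d L)) :
        Matrix (Idx (SB d L)) (Idx (SB d L)) ℚ) with hX'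
    have hpt : ∀ w : SB d L × SB d L × SB d L, |(symTTab (toSite r) L μ 0 (w.1 : Bond d) (w.2.1 : Bond d) (w.2.2 : Bond d) : ℝ)|
        ≤ |(X Idx.nil (Idx.three w.1 w.2.1 w.2.2) : ℝ)| + |(X' Idx.nil (Idx.three w.1 w.2.2 w.2.1) : ℝ)|
          + |(X Idx.nil (Idx.three w.2.1 w.1 w.2.2) : ℝ)| := by
      intro w
      have h1 := symATab_eq_entry (toSite r) L μ w
      have h2 := symApTab_eq_entry (toSite r) L μ (w.1, w.2.2, w.2.1)
      have h3 := symATab_eq_entry (toSite r) L μ (w.2.1, w.1, w.2.2)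
      dsimp only at h2 h3
      rw [← hX] at h1 h3
      rw [← hX'] at h2
      rw [symTTab, Rat.cast_sub, Rat.cast_add, h1, h2, h3]
      have := abs_add_le ((X Idx.nil (Idx.three w.1 w.2.1 w.2.2) : ℚ) : ℝ) ((X' Idx.nil (Idx.three w.1 w.2.2 w.2.1) : ℚ) : ℝ)
      have := abs_sub (((X Idx.nil (Idx.three w.1 w.2.1 w.2.2) : ℚ) : ℝ) + ((X' Idx.nil (Idx.three w.1 w.2.2 w.2.1) : ℚ) : ℝ))
        ((X Idx.nil (Idx.three w.2.1 w.1 w.2.2) : ℚ) : ℝ)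
      linarith
    have hs1 : ∑ w : SB d L × SB d L × SB d L, |(X' Idx.nil (Idx.three w.1 w.2.2 w.2.1) : ℝ)|
        = ∑ w : SB d L × SB d L × SB d L, |(X' Idx.nil (Idx.three w.1 w.2.1 w.2.2) : ℝ)| :=
      Fintype.sum_equiv e₁ _ _ fun _ => rfl
    have hs2 : ∑ w : SB d L × SB d L × SB d L, |(X Idx.nil (Idx.three w.2.1 w.1 w.2.2) : ℝ)|
        = ∑ w : SB d L × SB d L × SB d L, |(X Idx.nil (Idx.three w.1 w.2.1 w.2.2) : ℝ)| :=
      Fintype.sum_equiv e₂ _ _ fun _ => rfl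
    refine (Finset.sum_le_sum fun w _ => hpt w).trans ?_
    rw [Finset.sum_add_distrib, Finset.sum_add_distrib, hs1, hs2]
    linarith [hA μ, hA' μ]
  unfold symMixAbs tripleAbs
  calc ∑ μ : Fin d, ∑ p ∈ (bondSet d L ×ˢ bondSet d L) ×ˢ bondSet d L, |(symTTab (toSite r) L μ 0 p.1.1 p.1.2 p.2 : ℝ)|
      ≤ ∑ _μ : Fin d, 75000 * (ell d L : ℝ) ^ 3 := Finset.sum_le_sum fun μ _ => hμ μ
    _ = 75000 * d * (ell d L : ℝ) ^ 3 := by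
        rw [Finset.sum_const, Finset.card_univ, Fintype.card_fin, nsmul_eq_mul]; ring

/-- [folklore] **AT THE CENTRED ROOT**: `symMixAbs (ctr d n) n ≤ 75000 · d · ((2d+2)·n)³` for `1 ≤ n` (at the road's `d = 4`: `≤ 3·10⁸ · n³`). -/
theorem symMixAbs_ctr_le {n : ℕ} (hn : 1 ≤ n) :
    symMixAbs (ctr d n) n ≤ 75000 * d * (((2 * d + 2) * n : ℕ) : ℝ) ^ 3 := by
  have h := symMixAbs_le hn (ctrOff_mem_box (d := d) hn)
  exact h

end Main



end Summit.QuantumFields.BalabanUV.Beta.D1BFx.SymMixedTableMass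

end
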